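import Summits.QuantumFields.BalabanUV.Beta.GAN24.WilsonSectorUndressedRow
import Literature.MathematicalPhysics.QuantumFieldTheory.Balaban1983to89.Beta.SecondOrderResponse

/-!
# `BalabanUV.Beta.GAN24.OneShotMixedChannels` — binder row G-an2-4 / (CONV-C), CT-ROUTE, the hS0 assembly for the BORN sectors of the comb family
# (row owner's `gen19/BORNSEC-PLAN-v0.md` (V2)): **(E-α-B) FOR THE MIXED CHANNELS** — the one-shot third jet `e3OfS N S` of a LOCAL stencil family
# `S` with entries in all four fibre channels is the sum of FOUR three-leg pushes through the UNDRESSED legs of the one-shot packed resolvent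
# `KInv N`: the field legs `±B`, `B = respStep 1 N` (part A's dictionary), and the multiplier-slot legs `colM (KInv N) N` ∕ `rowMM (KInv N) N`,
# which this file reads off an5's `KInv` as `wΦ`-blocks supported on the coarse sublattice

NOT IN PRINT; OUR BOOKKEEPING (G-an2-4 formalisation swarm, leaf prover `b2b-balaban-gan24-formalise-leaf-03`, gen 52; the owner's (V2) «[owner or
leaf-03; S]», MINE of record).  HONEST FRAMING (cell contract, verbatim): «discharging `BetaPertH` makes Bałaban's UV stability UNCONDITIONAL — a real
constructive-QFT result; it is NOT the continuum limit and NOT the Clay problem.»  HONEST DEPENDENCY (verbatim): «continuum YM on T⁴ ⇐ BetaPertH ∧ nine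
spine estimates (0/9 proved); BetaPertH ⇐ (D1) ∧ (D4) ∧ CAP+tail; G-an2-4 gates asym, D1 and NE2/3/4.»  [folklore] throughout: leaf-05's
`e3OfS_eq_e3K`, leaf-01's FOUR-CHANNEL READ `SrecLinearPartEq.e3K_eq_neg_sum_push₃` at `K = KInv N` (lit `decays_KInv`), part A's
`rowM_KInv_eq_neg_respStep_one` ∕ `colH_KInv_eq_respStep_one`, an5's `KInv_inr_inr_coarse` ∕ `KInv_inr_off`, `push₃_neg_left`.  No cited fact, no wall
binder, no `def`, no `def … : Prop`, no sorry.  NO estimate; discharges NOTHING of (hS, hSall) on (E).  NEVER «G-an2-4 closed»; NOT (CONV-C), NOT hS0,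
NOT D1, NOT `BetaPertH`, NOT continuum, NOT Clay.

WHY (the plan's (V3)∕(V6)): road S3's rows V ∕ Λ bound `e3OfS N (border ∕ Λ tables)`; the border table is fm∕mf-valued, so its one-shot third jet lives
in the two MIXED channels, whose kernel legs are one field leg `±B` and one multiplier-slot leg; the DRESSED twin, channel for channel, is leaf-01 g43's
`RespStepBm.e3K_coDressKBmAt_KStepUnit` (field legs dressed `∓respStepBm`, multiplier-slot legs `rowMM ∕ colM (KStepUnit Lc j) Lc` undressed) — so
«dressed − undressed» for the born sectors is a per-channel telescope in the FIELD legs only.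

## What is proved (generic `d`, `[NeZero N]`)
* §1 the multiplier-slot legs of `KInv N`: `colM_KInv_apply` (`colM (KInv N) N β z′ μ z = if proj N z = 0 then wΦ μ β (quo N z − z′) else 0`),
  `colM_KInv_zsmul` (`… μ (N•w′) = wΦ μ β (w′ − z′)`), `colM_KInv_off`; `rowMM_KInv_apply` ∕ `rowMM_KInv_zsmul` ∕ `rowMM_KInv_off`; the bridge
  `colM_KInv_zsmul_eq_carrier` to an5's lit carrier `SecondOrderResponse.colM` (both slots coarse); `exists_legDecay_colM_rowMM_KInv`.
* §2 **`e3OfS_eq_four_push₃`**: for `LocStencil S Cs δ`, `0 < δ`: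
  `e3OfS N S κ′ u′ = push₃ B B B (reslot inl inl S) κ′ u′ + push₃ B (colM (KInv N) N) B (reslot inl inr S) κ′ u′`
  `− push₃ (rowMM (KInv N) N) B B (reslot inr inl S) κ′ u′ − push₃ (rowMM (KInv N) N) (colM (KInv N) N) B (reslot inr inr S) κ′ u′`;
  **`e3OfS_eq_two_push₃_of_mixed`**: if the ff and mm blocks of `S` vanish (the border table's case), only the two mixed channels remain.
  ((E-α-B) `WilsonSectorUndressedRow.e3OfS_eq_push₃` is the ff case; not restated.)
Unit `b2b-balaban-gan24-formalise-leaf-03` (gen 52), 2026-08-21.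
-/

noncomputable section

open Finset
open scoped BigOperators
open Literature.MathematicalPhysics.QuantumFieldTheory
open Literature.MathematicalPhysics.QuantumFieldTheory.LatticeForm (quo)
open Literature.MathematicalPhysics.QuantumFieldTheory.Balaban1983to89
open Literature.MathematicalPhysics.QuantumFieldTheory.Balaban1983to89.Beta
open Literature.Probability.LatticeModels (Torus.proj)
open ExpKernelCalculus (MKer Decays)
open OneStepResolventKernel (Fib LocStencil KInv KInv_inr_inr_coarse KInv_inr_off decays_KInv)
open KernelSpecInstance (wΦ)
open BalabanCompositeJets (respStep)
open Summit.QuantumFields.BalabanUV.Beta.GAN24.Push4Bounds (LegDecay)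
open Summit.QuantumFields.BalabanUV.Beta.GAN24.Push3 (push₃)
open Summit.QuantumFields.BalabanUV.Beta.GAN24.Push3LegTelescope (push₃_neg_left)
open Summit.QuantumFields.BalabanUV.Beta.GAN24.E3UnitSplit (e3OfS)
open Summit.QuantumFields.BalabanUV.Beta.GAN24.ThirdJetKernel (e3OfS_eq_e3K)
open Summit.QuantumFields.BalabanUV.Beta.GAN24.SrecLinearPartEq (colM rowMM colM_apply rowMM_apply reslot legDecay_colM legDecay_rowMM
  e3K_eq_neg_sum_push₃ push₃_zero)
open Summit.QuantumFields.BalabanUV.Beta.GAN24.WilsonSectorUndressedRow (rowM_KInv_eq_neg_respStep_one colH_KInv_eq_respStep_one)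

namespace Summit.QuantumFields.BalabanUV.Beta.GAN24.OneShotMixedChannels

variable {d : ℕ} {N : ℕ} [NeZero N]

/-! ## §1 The multiplier-slot legs of the one-shot packed resolvent -/

/-- [folklore] **THE mm-COLUMN LEG OF `KInv N`**: supported on the coarse sublattice in its fine index, where it is an5's multiplier response block
`wΦ`: `colM (KInv N) N β z′ μ z = if proj N z = 0 then wΦ μ β (quo N z − z′) else 0`. -/
theorem colM_KInv_apply (β : Fin (d + 1)) (z' : Fin (d + 1) → ℤ) (μ : Fin (d + 1)) (z : Fin (d + 1) → ℤ) :
    colM (KInv (N := N) (d := d)) N β z' μ z = if Torus.proj N z = 0 then wΦ (N := N) μ β (quo N z - z') else 0 := by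
  rw [colM_apply]
  simp only [KInv, OneStepResolventKernel.proj_zsmul, OneStepResolventKernel.quo_zsmul, and_true]

/-- [folklore] … at a coarse point: `colM (KInv N) N β z′ μ (N•w′) = wΦ μ β (w′ − z′)`. -/
theorem colM_KInv_zsmul (β : Fin (d + 1)) (z' : Fin (d + 1) → ℤ) (μ : Fin (d + 1)) (w' : Fin (d + 1) → ℤ) :
    colM (KInv (N := N) (d := d)) N β z' μ ((N : ℤ) • w') = wΦ (N := N) μ β (w' - z') := by
  rw [colM_apply, KInv_inr_inr_coarse]

/-- [folklore] … off the coarse sublattice it vanishes. -/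
theorem colM_KInv_off (β : Fin (d + 1)) (z' : Fin (d + 1) → ℤ) (μ : Fin (d + 1)) {z : Fin (d + 1) → ℤ} (hz : Torus.proj N z ≠ 0) :
    colM (KInv (N := N) (d := d)) N β z' μ z = 0 := by
  rw [colM_apply, KInv_inr_off hz]

/-- [folklore] **THE mm-ROW LEG OF `KInv N`**: `rowMM (KInv N) N α x′ μ x = if proj N x = 0 then wΦ α μ (x′ − quo N x) else 0`. -/
theorem rowMM_KInv_apply (α : Fin (d + 1)) (x' : Fin (d + 1) → ℤ) (μ : Fin (d + 1)) (x : Fin (d + 1) → ℤ) :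
    rowMM (KInv (N := N) (d := d)) N α x' μ x = if Torus.proj N x = 0 then wΦ (N := N) α μ (x' - quo N x) else 0 := by
  rw [rowMM_apply]
  simp only [KInv, OneStepResolventKernel.proj_zsmul, OneStepResolventKernel.quo_zsmul, true_and]

/-- [folklore] … at a coarse point: `rowMM (KInv N) N α x′ μ (N•w′) = wΦ α μ (x′ − w′)`. -/
theorem rowMM_KInv_zsmul (α : Fin (d + 1)) (x' : Fin (d + 1) → ℤ) (μ : Fin (d + 1)) (w' : Fin (d + 1) → ℤ) :
    rowMM (KInv (N := N) (d := d)) N α x' μ ((N : ℤ) • w') = wΦ (N := N) α μ (x' - w') := by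
  rw [rowMM_apply, KInv_inr_inr_coarse]

/-- [folklore] … off the coarse sublattice it vanishes. -/
theorem rowMM_KInv_off (α : Fin (d + 1)) (x' : Fin (d + 1) → ℤ) (μ : Fin (d + 1)) {x : Fin (d + 1) → ℤ} (hx : Torus.proj N x ≠ 0) :
    rowMM (KInv (N := N) (d := d)) N α x' μ x = 0 := by
  rw [rowMM_KInv_apply, if_neg hx]

/-- [folklore] **BRIDGE TO an5's CARRIER**: at a coarse fine-index the mm-column leg of `SrecLinearPartEq` IS the lit multiplier column
`SecondOrderResponse.colM` (both slots coarse; lit `colM_KInv` reads it as `wΦ`), by `rfl`. -/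
theorem colM_KInv_zsmul_eq_carrier (β : Fin (d + 1)) (z' : Fin (d + 1) → ℤ) (μ : Fin (d + 1)) (w' : Fin (d + 1) → ℤ) :
    colM (KInv (N := N) (d := d)) N β z' μ ((N : ℤ) • w') = SecondOrderResponse.colM (KInv (N := N) (d := d)) N β z' μ w' := rfl

/-- [folklore] Both multiplier-slot legs of `KInv N` are localised leg families (lit `decays_KInv`). -/
theorem exists_legDecay_colM_rowMM_KInv :
    ∃ δ C : ℝ, 0 < δ ∧ 0 ≤ C ∧ LegDecay (colM (KInv (N := N) (d := d)) N) N C δ ∧ LegDecay (rowMM (KInv (N := N) (d := d)) N) N C δ := by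
  obtain ⟨δ, C, hδ, hC, hK⟩ := decays_KInv (N := N) (d := d)
  exact ⟨δ, C, hδ, hC, legDecay_colM hK, legDecay_rowMM hK⟩

/-! ## §2 (E-α-B) for the mixed channels: the one-shot third jet as four pushes through the undressed legs -/

/-- NOT IN PRINT; OUR BOOKKEEPING.  **THE ONE-SHOT THIRD JET OF A LOCAL STENCIL FAMILY IS FOUR THREE-LEG PUSHES THROUGH THE UNDRESSED LEGS OF
`KInv N`**, one per fibre channel of the stencil entries (`B = respStep 1 N`; table leg `B` in all four; kernel legs `B` ∕ `colM (KInv N) N` on the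
right and `B` ∕ `rowMM (KInv N) N` on the left, the mm-row channels with a MINUS from `rowM (KInv N) N = −B`):
`e3OfS N S = push₃ B B B S_ff + push₃ B colM B S_fm − push₃ rowMM B B S_mf − push₃ rowMM colM B S_mm`. -/
theorem e3OfS_eq_four_push₃ {S : Fin (d + 1) → (Fin (d + 1) → ℤ) → MKer (d + 1) (Fib d)} {Cs δ : ℝ} (hS : LocStencil S Cs δ) (hδ : 0 < δ)
    (κ' : Fin (d + 1)) (u' : Fin (d + 1) → ℤ) :
    e3OfS N S κ' u'
      = push₃ (respStep (d := d) 1 N) (respStep (d := d) 1 N) (respStep (d := d) 1 N) (reslot Sum.inl Sum.inl S) κ' u'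
        + push₃ (respStep (d := d) 1 N) (colM (KInv (N := N) (d := d)) N) (respStep (d := d) 1 N) (reslot Sum.inl Sum.inr S) κ' u'
        - push₃ (rowMM (KInv (N := N) (d := d)) N) (respStep (d := d) 1 N) (respStep (d := d) 1 N) (reslot Sum.inr Sum.inl S) κ' u'
        - push₃ (rowMM (KInv (N := N) (d := d)) N) (colM (KInv (N := N) (d := d)) N) (respStep (d := d) 1 N)
            (reslot Sum.inr Sum.inr S) κ' u' := by
  obtain ⟨δ', C', hδ', -, hK⟩ := decays_KInv (N := N) (d := d)
  rw [e3OfS_eq_e3K, e3K_eq_neg_sum_push₃ hK hδ' N hS hδ κ' u', rowM_KInv_eq_neg_respStep_one, colH_KInv_eq_respStep_one,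
    push₃_neg_left, push₃_neg_left]
  abel

/-- NOT IN PRINT; OUR BOOKKEEPING.  **THE BORDER-TABLE CASE: ONLY THE TWO MIXED CHANNELS.**  If the ff and mm re-slots of `S` vanish
(`reslot inl inl S = 0`, `reslot inr inr S = 0` as families), then
`e3OfS N S κ′ u′ = push₃ B (colM (KInv N) N) B (reslot inl inr S) κ′ u′ − push₃ (rowMM (KInv N) N) B B (reslot inr inl S) κ′ u′`. -/
theorem e3OfS_eq_two_push₃_of_mixed {S : Fin (d + 1) → (Fin (d + 1) → ℤ) → MKer (d + 1) (Fib d)} {Cs δ : ℝ} (hS : LocStencil S Cs δ)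
    (hδ : 0 < δ) (hff : reslot Sum.inl Sum.inl S = fun _ _ => 0) (hmm : reslot Sum.inr Sum.inr S = fun _ _ => 0)
    (κ' : Fin (d + 1)) (u' : Fin (d + 1) → ℤ) :
    e3OfS N S κ' u'
      = push₃ (respStep (d := d) 1 N) (colM (KInv (N := N) (d := d)) N) (respStep (d := d) 1 N) (reslot Sum.inl Sum.inr S) κ' u'
        - push₃ (rowMM (KInv (N := N) (d := d)) N) (respStep (d := d) 1 N) (respStep (d := d) 1 N) (reslot Sum.inr Sum.inl S) κ' u' := by
  rw [e3OfS_eq_four_push₃ hS hδ, hff, hmm, push₃_zero, push₃_zero, zero_add, sub_zero]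

end Summit.QuantumFields.BalabanUV.Beta.GAN24.OneShotMixedChannels

end
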